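import Mathlib
import HarnessLib
import Literature.MathematicalPhysics.StatisticalMechanics.LinearisedMapABKMContraction
import Literature.MathematicalPhysics.StatisticalMechanics.PolymerClosureGainTorus

/-!
# Lemma 10.1 of [ABKM19] for the torus data WITHOUT the closure-gain hypothesis

`LinearisedMapABKMContraction.weakNormLE_opC_abkm` ([ABKM19] Lemma 10.1 for the concrete
renormalisation-group data on `M = L^N`) carries the closure gain `η |X̄|_{k+1} ≤ |X|_k` for large
connected `k`-polymers (Brydges 2009, Lemma 6.15) as a hypothesis `hgain`, formerly supplied only by
the named fact `TorusPolymer.BrydgesClosureGain d`.  `PolymerClosureGainTorus.closureGain` now PROVES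
the gain on every torus `M = L·s·t` with `t ≠ 3` — in particular on `M = L^N` at every scale
`k + 1 ≤ N` — with the dimensional constant `η(d) = 1 + (2(2^d+1)+6)^{−d} > 1`.  This file records the
resulting hypothesis-free form `weakNormLE_opC_abkm_gain` of Lemma 10.1 (same conclusion,
`η := η(d)` written out; the largeness condition on `A` is stated at this `η`).

## References
* S. Adams, S. Buchholz, R. Kotecký, S. Müller, arXiv:1910.13564, Lemma 10.1, Lemma 10.2 and
  App. A Lemma A.1 [AdamsBuchholzKoteckyMuller2019].
* D. C. Brydges, IAS/Park City Math. Ser. 16 (2009), Lemma 6.15 [Brydges2009].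
-/

noncomputable section

namespace Literature.MathematicalPhysics.StatisticalMechanics.GradientRG

open scoped BigOperators Classical MatrixOrder
open Finset Matrix
open Literature.MathematicalPhysics.StatisticalMechanics.GradientFRD (cExt fourierCoeff mulMat)
open Literature.MathematicalPhysics.StatisticalMechanics.TorusPolymer
open Literature.Barriers.CriticalPhenomena.LongRangePhi4.Polymer (IsConn)
open Literature.MathematicalPhysics.QuantumFieldTheory

variable {d M : ℕ} [NeZero M]

/-- **The closure gain at every scale of the torus `M = L^N`** (`L` odd, `L ≥ 2^d + 1`, `L ≥ 4`,
`k + 1 ≤ N`): `η(d)·|X̄|_{k+1} ≤ |X|_k` for connected `k`-polymers with more than `2^d` blocks —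
the hypothesis `hgain` of `weakNormLE_opC_abkm`, discharged. [cite: Brydges2009, Lemma 6.15] -/
theorem closureGain_pow {L N k : ℕ} (hLodd : Odd L) (hL2 : 2 ^ d + 1 ≤ L) (hL4 : 4 ≤ L) (hM : M = L ^ N)
    (hkN : k + 1 ≤ N) {X : Finset (Fin d → ZMod M)} (hX : IsPolymer (L ^ k) X) (hc : IsConn X)
    (hlarge : 2 ^ d < (blocks (L ^ k) X).card) :
    (1 + 1 / ((2 * (2 ^ d + 1) + 6 : ℝ) ^ d)) * ((blocks (L * L ^ k) (closure (L * L ^ k) X)).card : ℝ) ≤ (blocks (L ^ k) X).card := by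
  have hMeq : M = L * L ^ k * L ^ (N - k - 1) := by
    rw [hM, ← pow_succ', ← pow_add]; congr 1; omega
  have ht3 : L ^ (N - k - 1) ≠ 3 := by
    rcases Nat.eq_zero_or_pos (N - k - 1) with h0 | h0
    · rw [h0, pow_zero]; norm_num
    · intro h3
      have : L ≤ L ^ (N - k - 1) := Nat.le_self_pow (by omega) L
      omega
  exact closureGain hMeq hLodd.pow hLodd hLodd.pow ht3 hL2 hX hc hlarge

/-- **[ABKM19] Lemma 10.1 for the torus data, closure gain discharged**: the statement of
`weakNormLE_opC_abkm` with `η := 1 + (2(2^d+1)+6)^{−d}` and without the hypothesis `hgain` (supplied by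
`closureGain_pow`, i.e. by Brydges' Lemma 6.15 proved in `PolymerClosureGainTorus`).
[cite: AdamsBuchholzKoteckyMuller2019, Lemma 10.1] -/
theorem weakNormLE_opC_abkm_gain {L N Mord R n p r₀ : ℕ} {θbar lam μ δ₁ δ₀ A𝒫 h A : ℝ}
    {𝒞 : ℕ → (Fin d → ZMod M) → ℝ} (hd : 3 ≤ d) (hLodd : Odd L) (hL : 2 ^ (d + 3) + 16 * R ≤ L)
    (hM : M = L ^ N) {k : ℕ} (hkN : k + 1 ≤ N) (hp : d / 2 + 2 ≤ p) (hpM : p + d ≤ Mord)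
    (hMR : Mord ≤ R) (hr₀ : 3 ≤ r₀) (hθbar : 0 < θbar) (hlam : 0 < lam)
    (hB : AbkmWeightBounds L N Mord R n θbar lam μ δ₁ δ₀ A𝒫 𝒞
      (abkmWeightData L N Mord R θbar (schedDelta δ₀ δ₁ N) 𝒞))
    (hδ₀ : 0 < δ₀) (hδ₁ : 0 < δ₁) (hh : 0 < h) (hh0 : hZeroSq d R δ₀ δ₁ ≤ h ^ 2)
    (hA𝒫 : 0 ≤ A𝒫) (hA : 1 ≤ A) (hA𝒫A : A𝒫 ≤ A)
    (hsmall : (2 : ℝ) ^ (L ^ d) * (A𝒫 * A ^ (-(1 - (1 + 1 / ((2 * (2 ^ d + 1) + 6 : ℝ) ^ d))⁻¹) : ℝ)) ≤ 1)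
    -- the step data of scale `k`
    (D : StepData d M) (hDs : D.s = L ^ k) (hDL : D.L = L) (hD𝒞 : D.𝒞 = 𝒞 (k + 1))
    {x₀ : Fin d → ZMod M} (hB₀ : D.B₀ = blockOf (L ^ k) x₀)
    (hc₀ : D.c₀ = boxCorner (L ^ k) (starRad R L d k) x₀)
    -- the activity
    {K : Finset (Fin d → ZMod M) → ((Fin d → ZMod M) → ℝ) → ℂ} {C : ℝ} (hC : 0 ≤ C)
    (hK : WeakNormLE (abkmNormParams L N Mord R p r₀ h θbar A (schedDelta δ₀ δ₁ N) 𝒞) k K C)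
    (hKt : TransInv (L ^ k) K) (hKd : ∀ X, ContDiff ℝ r₀ (K X))
    (hKloc : ∀ X, IsPolymer (L ^ k) X → IsConn X →
      IsGaugeLocal ((abkmNormParams L N Mord R p r₀ h θbar A (schedDelta δ₀ δ₁ N) 𝒞).gauge k X) (K X))
    (hRd : ∀ X, ContDiff ℝ r₀ (fluct (𝒞 (k + 1)) (K X))) :
    WeakNormLE (abkmNormParams L N Mord R p r₀ h θbar A (schedDelta δ₀ δ₁ N) 𝒞) (k + 1) (opC D K)
      (C * ((L : ℝ) ^ d * (A𝒫 * abkmContrConst d L R) + largePartEps d L A A𝒫 (1 + 1 / ((2 * (2 ^ d + 1) + 6 : ℝ) ^ d))))  := by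
  have h8 : 8 ≤ 2 ^ (d + 3) := by
    calc 8 = 2 ^ 3 := by norm_num
      _ ≤ 2 ^ (d + 3) := Nat.pow_le_pow_right (by norm_num) (by omega)
  have h2dle : 2 ^ d ≤ 2 ^ (d + 3) := Nat.pow_le_pow_right (by norm_num) (by omega)
  have hL2 : 2 ^ d + 1 ≤ L := by omega
  have hL4 : 4 ≤ L := by omega
  exact weakNormLE_opC_abkm hd hLodd hL hM hkN hp hpM hMR hr₀ hθbar hlam hB hδ₀ hδ₁ hh hh0 hA𝒫 hA hA𝒫A
    (by positivity) hsmall (fun X hX hc hl => closureGain_pow hLodd hL2 hL4 hM hkN hX hc hl)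
    D hDs hDL hD𝒞 hB₀ hc₀ hC hK hKt hKd hKloc hRd

end Literature.MathematicalPhysics.StatisticalMechanics.GradientRG

end
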